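import Summits.BirchSwinnertonDyer.BirchSwinnertonDyer.Theses.ErratumRoadFive
import Summits.BirchSwinnertonDyer.BirchSwinnertonDyer.Theorems.ErratumRoadFiveNonSurjCornerTwinMuAnFrameShape
import Summits.BirchSwinnertonDyer.Rank1Residual.X11a.MuLambdaSplit
import HarnessLib

/-!
# Route `ErratumRoadFive` (K2), crux `NonSurjCorner` (item stmt-BirchSwinnertonDyer-19065), gen-3 child
# `NonSurjCornerTwinMuAnDeep` (item stmt-BirchSwinnertonDyer-23047): THE DEEP CHILD FROM PER-PAIR DATA — on the `t = 0`
# sub-corner (`p ∤ ∏c(E)`) the μ-clause of EVERY Friedberg–Hoffstein twin is «`p ∤ #Ш(E^{(d_K)})_an`», and the ROUTE DECL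
# follows, modulo GZK by name, from that indivisibility (or a lane certificate) at the twins of the deep pairs only
# (cell `bsd-stepL`, WIDTH-LEVER lane B `bsd-stepL-corner5-p2` g12; `--supports stmt-BirchSwinnertonDyer-23047 --as helper`)

WHY. The phase-1b re-split of `NonSurjCorner` (planner RULING 68, ER5 rev 58) retired the full-class child 19948
`NonSurjCornerTwinMuAn` and asks analytic `μ = 0` ONLY at the Friedberg–Hoffstein twins `Wd = Cd • E^{(d_K)}` of the DEEP corner
pairs (`0 < ord_p #Ш(E)_an`). Lane B's doors of record (`…TwinMuAnOfTables`, `…TwinMuAnRhoBarInvariance`, `…TwinMuAnFrameShape`)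
conclude the RETIRED decl or are keyed to the retired 23-fact bundle `KatoTwinFactsFiveAn`. This file re-keys the lane's two
cheapest currencies to the LIVE decl `Theses.ErratumRoadFive.NonSurjCornerTwinMuAnDeep` with ONE named fact (GZK,
`rank_eq_analyticRank_of_analyticRank_le_one`, a conjunct of the live support item 23048 `KatoTwinFactsFiveAnContra`):

* §1 `NonSurjCornerDeep.twinMuAn_clause_of_not_dvd_tamagawaProduct_of_shaAn_unit` — at a corner pair `(E,p)` with
  `p ∤ ∏c(E)` (the `t = 0` sub-corner; then `p` is NON-split, lane B g4) and a Heegner frame `K`, the μ-clause of 23047 at the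
  twin `Wd` (every newform `f`, period ratio `ϖ`, allowable root `a`, Mazur–Tate–Teitelbaum function `L`) holds as soon as
  `#Ш(Wd)_an = q` with `ord_p q = 0`: the twin is non-split at `p` and `p ∤ ∏c(Wd)` (frame transport, g7 `HeegnerTwin.*` over the b2b
  twist-transport theorems), so `a = −1` and `[T⁰](ϖ·L) = 2ϖ[0]⁺_f = 2q∏c(Wd)/#tors²` is a `p`-adic unit (g7
  `MuAnUnit.norm_coeff_zero_C_mul_eq_one_iff_of_neg_one_of_nonneg`).
* §2 `NonSurjCornerDeep.twinMuAnDeep_of_laneCertificatesDeep` — the live decl from the X11a lane certificate `X11a.MuAnZeroAt Wd p`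
  at every Friedberg–Hoffstein twin of every DEEP corner pair (the deep analogue of `NonSurjTwin.twinMuAn_of_laneCertificates`; fact-free).
* §3 `NonSurjCornerDeep.twinMuAnDeep_of_pairData` — the live decl from, at every DEEP corner pair, EITHER «`p ∤ ∏c(E)` and every
  Friedberg–Hoffstein twin has `p`-adic-unit `#Ш_an`» OR «every Friedberg–Hoffstein twin carries the lane certificate» (GZK by name).

So the in-range content of 23047 reads off lane B's DEEP census (g9 CENSUS-G9, `N ≤ 4·10¹⁰`; g12 kit `deeptwin` ∕ `shafill`): the one
known deep pair at `p = 5`, `E* = J9t-73o125d-14` (`N = 5 112 322 880`, `#Ш_an = 25`, non-split, `∏c = 2`), contributes exactly the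
indivisibilities «`5 ∤ #Ш(E*^{(d_K)})_an`» over its Heegner fields `K` — OPEN as a family (Ono–Skinner ∕ Kriz–Li type statements do not
cover an exceptional `p ∣ N`), decidable field by field.

HONEST FRAMING: theorems only (no definition, no new named fact, no `sorry`); §1 and §3 are CONDITIONAL on GZK by name; nothing is
asserted about any curve; items 19065 ∕ 23047 stay OPEN (class-wide = Greenberg's Conj. 1.11 on the corner's residual classes); no census
word, tier or label moves (T7); BSD is proved for no curve or class.
References: [MazurTateTeitelbaum1986Invent] §I.10 (ε(p) = 0), §I.12–I.14; [GreenbergLNM1716] §1 Conj. 1.11 (p. 61), §4 (PDF p. 113);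
[JetchevSkinnerWan2017] §7.4.1 (eq:tamK); [Miller2011LMS] §1; [OnoSkinner1998] Cor. 3 (shape only); tree: `…TwinMuAnFrameShape` (g7),
`…TwinMuAnCertificateShape` (g7), `…TwinMuAnOfTables` (g8), b2b `X11b/TwistTransport*.lean`.
-/

set_option autoImplicit false
set_option linter.dupNamespace false -- `Summit.BirchSwinnertonDyer.BirchSwinnertonDyer` (summit = problem), tree-wide

noncomputable section

open scoped Classical NumberField MatrixGroups ModularForm

namespace Summit.BirchSwinnertonDyer.BirchSwinnertonDyer.Theorems

open CongruenceSubgroup PowerSeries WeierstrassCurve IsDedekindDomain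
  Literature.NumberTheory.EllipticCurves Literature.NumberTheory.EllipticCurves.ModularForms
  Literature.NumberTheory.EllipticCurves.Rank1Residual Summit.BirchSwinnertonDyer.Rank1Residual
  Summit.BirchSwinnertonDyer.Rank1Residual.X11b.MuAnUnit
  Summit.BirchSwinnertonDyer.BirchSwinnertonDyer.Theorems.TatePow

/-! ### §1 The `t = 0` sub-corner: the μ-clause of a Friedberg–Hoffstein twin from `p ∤ #Ш(Wd)_an` -/

/-- **The μ-clause of 23047 at ONE twin of a `t = 0` corner pair from a unit `#Ш_an`.** `(E,p)` a corner pair (`ClassX11b`, `ρ̄`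
not onto, `p ∈ {5,7}`) with `p ∤ ∏c(E)`; `K` imaginary quadratic, Heegner for `N_E`; `Wd = Cd • E^{(d_K)}` a globally minimal X11a
twin; `#Ш(Wd)_an = q` with `q ≠ 0`, `ord_p q = 0`. Then for every newform `f` of `Wd`, `ϖ` (`ϖ·Ω_{Wd} = Ω⁺_f`), allowable root
`a` and `L` with `IsMultPAdicLFunctionOf f p a L`, SOME coefficient of `ϖ·L` is a `p`-adic unit — namely `[T⁰]`: `E` is non-split at
`p` (`p ∤ ∏c(E)` on the corner, lane B g4), hence so is the twin and `p ∤ ∏c(Wd)` (Heegner frame transport), so `a = −1` and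
`‖[T⁰](ϖ·L)‖ = ‖2q∏c(Wd)/#tors²‖ = 1`. CONDITIONAL on GZK by name (`Reg(Wd) = 1`). [cite: MazurTateTeitelbaum1986Invent, §I.10]
[cite: GreenbergLNM1716, §4 (PDF p. 113)] [cite: JetchevSkinnerWan2017, §7.4.1 (eq:tamK)] [cite: Miller2011LMS, §1] -/
theorem NonSurjCornerDeep.twinMuAn_clause_of_not_dvd_tamagawaProduct_of_shaAn_unit
    (hGZK : rank_eq_analyticRank_of_analyticRank_le_one)
    (W : WeierstrassCurve ℚ) [W.IsElliptic] [W.IsGloballyMinimal] (p : ℕ) [Fact p.Prime]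
    (hX : ClassX11b W p) (hns : ¬ Surj W p) (h57 : p = 5 ∨ p = 7) (ht0 : ¬ p ∣ W.tamagawaProduct)
    (K : Type) [Field K] [NumberField K] (hK : IsImaginaryQuadratic K)
    (hHN : SatisfiesHeegnerHypothesis (W.conductorNorm ℤ) K)
    (Wd : WeierstrassCurve ℚ) [Wd.IsElliptic] [Wd.IsGloballyMinimal] (Cd : VariableChange ℚ)
    (hWd : Cd • W.quadraticTwist (NumberField.discr K : ℚ) = Wd) (hXa : ClassX11a Wd p)
    (q : ℚ) (hq : shaAn Wd = (q : ℂ)) (hq0 : q ≠ 0) (hvq : padicValRat p q = 0) :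
    ∀ {N : ℕ} [NeZero N] (f : CuspForm (Gamma0 N) 2), IsNewformOf Wd f →
    ∀ (ϖ : ℚ), (ϖ : ℝ) * Wd.realPeriodRat = plusPeriod f →
    ∀ (a : ℚ_[p]) (L : PowerSeries ℚ_[p]),
      (Wd.HasSplitMultiplicativeReductionAtPrime p → a = 1) →
      (¬ Wd.HasSplitMultiplicativeReductionAtPrime p → a = -1) →
      IsMultPAdicLFunctionOf f p a L →
      ∃ n : ℕ, ‖PowerSeries.coeff n (PowerSeries.C ((ϖ : ℚ) : ℚ_[p]) * L)‖ = 1 := by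
  intro N _ f hf ϖ hϖ a L _ hna hL
  have hp5 : 5 ≤ p := by rcases h57 with rfl | rfl <;> norm_num
  have hp2 : p ≠ 2 := by omega
  -- `E` is non-split at `p` (t = 0 on the corner), hence so is the Heegner twin
  have hnspW : ¬ W.HasSplitMultiplicativeReductionAtPrime p :=
    CornerLocal.NonSurjCorner.not_hasSplitMultiplicativeReductionAtPrime_of_not_dvd_tamagawaProduct W p hX hns ht0 p
  have hnspWd : ¬ Wd.HasSplitMultiplicativeReductionAtPrime p := fun h ↦
    hnspW ((HeegnerTwin.hasSplitMultiplicativeReductionAtPrime_iff (W := W) (p := p) K hK hHN hX.2.2.1 Cd hWd).mp h)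
  -- `p ∤ ∏c(Wd)` by frame transport
  have htd : ¬ p ∣ Wd.tamagawaProduct := fun h ↦
    ht0 ((HeegnerTwin.dvd_tamagawaProduct_iff (W := W) (p := p) hp5 K hK hHN Cd hWd).mp h)
  have ha : a = -1 := hna hnspWd
  subst ha
  exact ⟨0, (norm_coeff_zero_C_mul_eq_one_iff_of_neg_one_of_nonneg hp2 hGZK hXa hf hϖ hL hq hq0 (le_of_eq hvq.symm)).mpr
    ⟨hvq, htd⟩⟩

/-! ### §2 The live route decl from the lane certificate at the twins of the DEEP pairs -/

/-- **23047 from the X11a lane certificate at every Friedberg–Hoffstein twin of every DEEP corner pair** (the deep analogue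
of `NonSurjTwin.twinMuAn_of_laneCertificates`, g8): at a split `p` the decl's `IsMultPAdicLFunctionOf f p 1 L` is the lane's
`IsSplitMultPAdicLFunctionOf f p L` (`isMultPAdicLFunctionOf_one_iff`), at a non-split `p` both read `IsMultPAdicLFunctionOf f p (-1) L`.
FACT-FREE bookkeeping; nothing asserted about any curve. [cite: MazurTateTeitelbaum1986Invent, §I.10 and §I.14]
[cite: GreenbergLNM1716, §1 Conj. 1.11 (p. 61) (shape)] -/
theorem NonSurjCornerDeep.twinMuAnDeep_of_laneCertificatesDeep
    (h : ∀ (W : WeierstrassCurve ℚ) [W.IsElliptic] [W.IsGloballyMinimal] (p : ℕ) [Fact p.Prime],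
      ClassX11b W p → ¬ Surj W p → (p = 5 ∨ p = 7) → p ∣ padicValInt p W.minimalDiscriminantInt →
      ¬ Ram W p → (∃ s : ℚ, shaAn W = (s : ℂ) ∧ 0 < padicValRat p s) →
      ∀ (K : Type) [Field K] [NumberField K] (Wd : WeierstrassCurve ℚ) [Wd.IsElliptic] [Wd.IsGloballyMinimal]
        (Cd : VariableChange ℚ),
        IsImaginaryQuadratic K → SatisfiesHeegnerHypothesis (W.conductorNorm ℤ) K →
        (W.quadraticTwist (NumberField.discr K : ℚ)).entireLFunction 1 ≠ 0 →
        Cd • W.quadraticTwist (NumberField.discr K : ℚ) = Wd →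
        ClassX11a Wd p → ¬ Surj Wd p → p ∣ padicValInt p Wd.minimalDiscriminantInt →
        X11a.MuAnZeroAt Wd p) :
    Summit.BirchSwinnertonDyer.BirchSwinnertonDyer.Theses.ErratumRoadFive.NonSurjCornerTwinMuAnDeep := by
  show Summit.BirchSwinnertonDyer.BirchSwinnertonDyer.Theorems.NonSurjCornerTwinMuAnDeep
  intro W _ _ p _ hX hns h57 hv hnram hsha K _ _ Wd _ _ Cd hK hHN hL1 hWd hXa hnsd hvd N _ f hf ϖ hϖ a L hsa hna hL
  obtain ⟨hnsp, hsp⟩ := h W p hX hns h57 hv hnram hsha K Wd Cd hK hHN hL1 hWd hXa hnsd hvd f hf ϖ hϖ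
  by_cases hsplit : Wd.HasSplitMultiplicativeReductionAtPrime p
  · have ha : a = 1 := hsa hsplit
    subst ha
    exact hsp hsplit L ((isMultPAdicLFunctionOf_one_iff L).mp hL)
  · have ha : a = -1 := hna hsplit
    subst ha
    exact hnsp hsplit L hL

/-! ### §3 The live route decl from per-pair data on the DEEP pairs -/

/-- **23047 from per-pair data at the DEEP corner pairs, GZK by name**: if at every DEEP corner pair `(E,p)` EITHER `p ∤ ∏c(E)` and
every Friedberg–Hoffstein twin `Wd = Cd • E^{(d_K)}` (`K` imaginary quadratic, Heegner for `N_E`, `L(E^{(d_K)},1) ≠ 0`; `Wd` a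
non-surjective X11a leaf with `p ∣ ord_p Δ_min`) has `#Ш(Wd)_an = q` with `q ≠ 0`, `ord_p q = 0` (§1: the unit VALUE `[T⁰]`), OR every
such twin carries the X11a lane certificate `X11a.MuAnZeroAt Wd p` (§2), then `Theses.ErratumRoadFive.NonSurjCornerTwinMuAnDeep`.
This is the shape lane B's deep census instantiates pair by pair; the `∀` over the deep pairs (and, at each, over its Heegner fields)
is exactly what is open. CONDITIONAL on GZK; nothing booked. [cite: MazurTateTeitelbaum1986Invent, §I.10 and §I.12–I.14]
[cite: GreenbergLNM1716, §1 Conj. 1.11 (p. 61)] [cite: JetchevSkinnerWan2017, §7.4.1 (eq:tamK)] [cite: Miller2011LMS, §1] -/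
theorem NonSurjCornerDeep.twinMuAnDeep_of_pairData (hGZK : rank_eq_analyticRank_of_analyticRank_le_one)
    (h : ∀ (W : WeierstrassCurve ℚ) [W.IsElliptic] [W.IsGloballyMinimal] (p : ℕ) [Fact p.Prime],
      ClassX11b W p → ¬ Surj W p → (p = 5 ∨ p = 7) → p ∣ padicValInt p W.minimalDiscriminantInt →
      ¬ Ram W p → (∃ s : ℚ, shaAn W = (s : ℂ) ∧ 0 < padicValRat p s) →
      (¬ p ∣ W.tamagawaProduct ∧
        ∀ (K : Type) [Field K] [NumberField K] (Wd : WeierstrassCurve ℚ) [Wd.IsElliptic] [Wd.IsGloballyMinimal]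
          (Cd : VariableChange ℚ),
          IsImaginaryQuadratic K → SatisfiesHeegnerHypothesis (W.conductorNorm ℤ) K →
          (W.quadraticTwist (NumberField.discr K : ℚ)).entireLFunction 1 ≠ 0 →
          Cd • W.quadraticTwist (NumberField.discr K : ℚ) = Wd →
          ClassX11a Wd p → ¬ Surj Wd p → p ∣ padicValInt p Wd.minimalDiscriminantInt →
          ∃ q : ℚ, shaAn Wd = (q : ℂ) ∧ q ≠ 0 ∧ padicValRat p q = 0) ∨
      (∀ (K : Type) [Field K] [NumberField K] (Wd : WeierstrassCurve ℚ) [Wd.IsElliptic] [Wd.IsGloballyMinimal]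
          (Cd : VariableChange ℚ),
          IsImaginaryQuadratic K → SatisfiesHeegnerHypothesis (W.conductorNorm ℤ) K →
          (W.quadraticTwist (NumberField.discr K : ℚ)).entireLFunction 1 ≠ 0 →
          Cd • W.quadraticTwist (NumberField.discr K : ℚ) = Wd →
          ClassX11a Wd p → ¬ Surj Wd p → p ∣ padicValInt p Wd.minimalDiscriminantInt →
          X11a.MuAnZeroAt Wd p)) :
    Summit.BirchSwinnertonDyer.BirchSwinnertonDyer.Theses.ErratumRoadFive.NonSurjCornerTwinMuAnDeep := by
  show Summit.BirchSwinnertonDyer.BirchSwinnertonDyer.Theorems.NonSurjCornerTwinMuAnDeep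
  intro W _ _ p _ hX hns h57 hv hnram hsha K _ _ Wd _ _ Cd hK hHN hL1 hWd hXa hnsd hvd N _ f hf ϖ hϖ a L hsa hna hL
  rcases h W p hX hns h57 hv hnram hsha with ⟨ht0, hunit⟩ | hcert
  · obtain ⟨q, hq, hq0, hvq⟩ := hunit K Wd Cd hK hHN hL1 hWd hXa hnsd hvd
    exact NonSurjCornerDeep.twinMuAn_clause_of_not_dvd_tamagawaProduct_of_shaAn_unit hGZK W p hX hns h57 ht0 K hK hHN Wd Cd
      hWd hXa q hq hq0 hvq f hf ϖ hϖ a L hsa hna hL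
  · obtain ⟨hnsp, hsp⟩ := hcert K Wd Cd hK hHN hL1 hWd hXa hnsd hvd f hf ϖ hϖ
    by_cases hsplit : Wd.HasSplitMultiplicativeReductionAtPrime p
    · have ha : a = 1 := hsa hsplit
      subst ha
      exact hsp hsplit L ((isMultPAdicLFunctionOf_one_iff L).mp hL)
    · have ha : a = -1 := hna hsplit
      subst ha
      exact hnsp hsplit L hL

end Summit.BirchSwinnertonDyer.BirchSwinnertonDyer.Theorems

end
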